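import Summits.CriticalPhenomena.PercolationContinuityZ3.Theorems.PercNearOneGluingNoHeavyQuantPoissonBinomialRatio
import HarnessLib

/-!
# QUANT lane R8 tool: the unit star row with the AVERAGE gate —
# `P(N_L ≤ k) ≤ 1 − (Σ_{i∈L} p_i)/|L|` whenever `Σ_{i∈L} p_i > 2k`

builds on p205010 (kernel theorem, internal audit signed; external expert review pending)

Support file (`--supports stmt-CriticalPhenomena-4575`), QUANT lane typer seat prim-quant-stmt (gen 12); memo
`run/shared/lean/prim/quant/prim-quant-stmt-g12/MTL-PROFILE-LP.md` §3–§5.  Theorems only; no definitions, no sorries, standard axioms.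

Setting of `…QuantPoissonBinomialRatio.lean`: independent gates `p : ι → [0,1]` (`prodBernoulli p` on `Set ι`, `ι` finite), a finset `L`,
`N_L(s) = #{i ∈ L | i ∈ s}`, `U_L = Σ_{i∈L} p_i`.

* `Quant.pb_levels_sum_one` — `Σ_{b ≤ |L|} P(N_L = b) = 1`;  `Quant.pb_real_le_eq_sum` — `P(N_L ≤ k) = Σ_{b ≤ k} P(N_L = b)`;
  `Quant.pb_mean` — `Σ_{b ≤ |L|} b·P(N_L = b) = U_L` (size-biasing `Quant.pb_sizeBias` summed over the levels).
* `Quant.pb_pmf_mono` — the pmf of `N_L` is nondecreasing on `[0, U_L]` (from `Quant.pb_ratio`).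
* `Quant.pb_smallBall_avg` — **the average-gate star row**: if `2k < U_L` then `|L|·P(N_L ≤ k) ≤ |L| − U_L`, i.e.
  (`Quant.pb_smallBall_avg_div`) `P(N_L ≤ k) ≤ 1 − U_L/|L|`.  This sharpens the unit case of the half-mean small-ball inequality
  (`Quant.halfMean_smallBall` / `IndepBlob.halfMean_smallBall`: bound `1 − min_i p_i`) to the MEAN gate `U_L/|L| ≥ min_i p_i`.
  Proof (three lines, no transport, no Cantelli): `|L|·P(N ≤ k) = Σ_{b≤k} (|L| − b)P(b) + Σ_{1≤b≤k} b·P(b)`; by monotonicity of the pmf up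
  to `2k ≤ U_L`, `b·P(b) ≤ b·P(2k+1−b) ≤ (|L| − (2k+1−b))·P(2k+1−b)` (`|L| ≥ 2k+1`); so `|L|·P(N ≤ k) ≤ Σ_{b ≤ 2k+1} (|L| − b)P(b) ≤
  Σ_b (|L| − b)P(b) = |L| − U_L`.  It is the `W = ∅` case of the profile conjecture (★) of the memo (FAR for 'hub + root blocks' from the
  Poisson ratio bound alone), and for Poisson-binomial laws it also follows from Hoeffding's 1956 extremal theorem (the binomial maximises
  `P(N ≤ k)` for `k ≤ U − 1`) combined with the binomial case; the direct proof here uses only `pb_ratio`.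
[this work]; [cite: Grimmett1999, §1.3 p. 10 (product measure)]; cf. Hoeffding 1956 (Ann. Math. Statist. 27, 713–721).
-/

noncomputable section

namespace Summit.CriticalPhenomena.PercolationContinuityZ3.Theorems

open MeasureTheory Finset
open Literature.Probability.LatticeModels
open Literature.Probability.Percolation
open scoped Classical

namespace Quant

variable {ι : Type*} [Fintype ι]

/-- The level events `{N_L = b}`, `b ≤ |L|`, exhaust the space: `Σ_{b ≤ |L|} P(N_L = b) = 1`. [folklore] -/
theorem pb_levels_sum_one (p : ι → unitInterval) (L : Finset ι) :
    ∑ b ∈ Finset.range (L.card + 1), (prodBernoulli p).real {s : Set ι | (L.filter fun x => x ∈ s).card = b} = 1 := by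
  set μ := prodBernoulli p with hμ
  have hmeas : ∀ S : Set (Set ι), MeasurableSet S := fun S => MeasurableSet.of_discrete
  have hdisj : (↑(Finset.range (L.card + 1)) : Set ℕ).PairwiseDisjoint
      fun b => {s : Set ι | (L.filter fun x => x ∈ s).card = b} := by
    intro b _ b' _ hbb'
    rw [Function.onFun, Set.disjoint_left]
    intro s hs hs'
    have h1 : (L.filter fun x => x ∈ s).card = b := hs
    have h2 : (L.filter fun x => x ∈ s).card = b' := hs'
    exact hbb' (h1.symm.trans h2)
  have hunion : (⋃ b ∈ Finset.range (L.card + 1), {s : Set ι | (L.filter fun x => x ∈ s).card = b}) = Set.univ := by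
    ext s
    simp only [Set.mem_iUnion, Set.mem_setOf_eq, Finset.mem_range, exists_prop, Set.mem_univ, iff_true]
    refine ⟨(L.filter fun x => x ∈ s).card, ?_, rfl⟩
    have := Finset.card_filter_le L (fun x => x ∈ s)
    omega
  rw [← measureReal_biUnion_finset hdisj (fun b _ => hmeas _) (fun b _ => measure_ne_top _ _), hunion]
  exact probReal_univ

/-- `P(N_L ≤ k) = Σ_{b ≤ k} P(N_L = b)`. [folklore] -/
theorem pb_real_le_eq_sum (p : ι → unitInterval) (L : Finset ι) (k : ℕ) :
    (prodBernoulli p).real {s : Set ι | (L.filter fun x => x ∈ s).card ≤ k} =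
      ∑ b ∈ Finset.range (k + 1), (prodBernoulli p).real {s : Set ι | (L.filter fun x => x ∈ s).card = b} := by
  set μ := prodBernoulli p with hμ
  have hmeas : ∀ S : Set (Set ι), MeasurableSet S := fun S => MeasurableSet.of_discrete
  have hdisj : (↑(Finset.range (k + 1)) : Set ℕ).PairwiseDisjoint
      fun b => {s : Set ι | (L.filter fun x => x ∈ s).card = b} := by
    intro b _ b' _ hbb'
    rw [Function.onFun, Set.disjoint_left]
    intro s hs hs'
    have h1 : (L.filter fun x => x ∈ s).card = b := hs
    have h2 : (L.filter fun x => x ∈ s).card = b' := hs'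
    exact hbb' (h1.symm.trans h2)
  have hunion : (⋃ b ∈ Finset.range (k + 1), {s : Set ι | (L.filter fun x => x ∈ s).card = b}) =
      {s : Set ι | (L.filter fun x => x ∈ s).card ≤ k} := by
    ext s
    simp only [Set.mem_iUnion, Set.mem_setOf_eq, Finset.mem_range, exists_prop]
    constructor
    · rintro ⟨b, hb, hsb⟩; omega
    · intro h; exact ⟨(L.filter fun x => x ∈ s).card, by omega, rfl⟩
  rw [← hunion, measureReal_biUnion_finset hdisj (fun b _ => hmeas _) (fun b _ => measure_ne_top _ _)]

/-- **Mean of the count**: `Σ_{b ≤ |L|} b·P(N_L = b) = U_L = Σ_{i∈L} p_i` (size-biasing summed over the levels). [folklore] -/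
theorem pb_mean (p : ι → unitInterval) (L : Finset ι) :
    ∑ b ∈ Finset.range (L.card + 1), (b : ℝ) * (prodBernoulli p).real {s : Set ι | (L.filter fun x => x ∈ s).card = b} =
      ∑ i ∈ L, (p i : ℝ) := by
  set μ := prodBernoulli p with hμ
  rw [Finset.sum_range_succ']
  simp only [Nat.cast_zero, zero_mul, add_zero]
  have hsb : ∀ b : ℕ, ((b + 1 : ℕ) : ℝ) * μ.real {s : Set ι | (L.filter fun x => x ∈ s).card = b + 1} =
      ∑ i ∈ L, (p i : ℝ) * μ.real {s : Set ι | ((L.erase i).filter fun x => x ∈ s).card = b} := by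
    intro b
    push_cast
    exact pb_sizeBias p L b
  rw [Finset.sum_congr rfl fun b _ => hsb b, Finset.sum_comm]
  refine Finset.sum_congr rfl fun i hi => ?_
  rw [← Finset.mul_sum]
  have hcard : (L.erase i).card + 1 = L.card := by
    rw [Finset.card_erase_of_mem hi]
    have := Finset.card_pos.2 ⟨i, hi⟩
    omega
  have h1 := pb_levels_sum_one p (L.erase i)
  rw [hcard] at h1
  rw [h1, mul_one]

/-- One step of monotonicity: `P(N_L = b) ≤ P(N_L = b+1)` for `b + 1 ≤ U_L` (from `pb_ratio`). [this work] -/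
theorem pb_pmf_mono_succ (p : ι → unitInterval) (L : Finset ι) (b : ℕ) (hbU : ((b : ℝ) + 1) ≤ ∑ i ∈ L, (p i : ℝ)) :
    (prodBernoulli p).real {s : Set ι | (L.filter fun x => x ∈ s).card = b} ≤
      (prodBernoulli p).real {s : Set ι | (L.filter fun x => x ∈ s).card = b + 1} := by
  set U : ℝ := ∑ i ∈ L, (p i : ℝ) with hU
  set P0 := (prodBernoulli p).real {s : Set ι | (L.filter fun x => x ∈ s).card = b} with hP0
  set P1 := (prodBernoulli p).real {s : Set ι | (L.filter fun x => x ∈ s).card = b + 1} with hP1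
  have hratio : U * P0 ≤ ((b : ℝ) + 1) * P1 := by
    have := pb_ratio p L (b + 1) (by omega) (by push_cast; exact hbU)
    simp only [Nat.add_sub_cancel] at this
    push_cast at this
    exact this
  have hP1 : 0 ≤ P1 := measureReal_nonneg
  have h2 : ((b : ℝ) + 1) * P1 ≤ U * P1 := mul_le_mul_of_nonneg_right hbU hP1
  have hUpos : 0 < U := by have : (0 : ℝ) ≤ b := Nat.cast_nonneg b; linarith
  have : U * P0 ≤ U * P1 := hratio.trans h2
  exact le_of_mul_le_mul_left this hUpos

/-- **The pmf of `N_L` is nondecreasing on `[0, U_L]`**: `P(N_L = b) ≤ P(N_L = b')` for `b ≤ b' ≤ U_L`. [this work] -/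
theorem pb_pmf_mono (p : ι → unitInterval) (L : Finset ι) {b b' : ℕ} (hbb' : b ≤ b') (hb'U : (b' : ℝ) ≤ ∑ i ∈ L, (p i : ℝ)) :
    (prodBernoulli p).real {s : Set ι | (L.filter fun x => x ∈ s).card = b} ≤
      (prodBernoulli p).real {s : Set ι | (L.filter fun x => x ∈ s).card = b'} := by
  induction b', hbb' using Nat.le_induction with
  | base => exact le_rfl
  | succ b' hbb' ih =>
    have h1 : (b' : ℝ) ≤ ∑ i ∈ L, (p i : ℝ) := by push_cast at hb'U; linarith
    exact (ih h1).trans (pb_pmf_mono_succ p L b' (by push_cast at hb'U; exact hb'U))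

/-- **The average-gate star row.**  If `2k < U_L = Σ_{i∈L} p_i` then `|L|·P(N_L ≤ k) ≤ |L| − U_L`.  Proof: `|L|·P(N ≤ k) =
Σ_{b≤k}(|L|−b)P(b) + Σ_{b≤k} b·P(b)`, and `b·P(b) ≤ b·P(2k+1−b) ≤ (|L| − (2k+1−b))·P(2k+1−b)` by monotonicity of the pmf up to
`2k ≤ U_L` and `|L| ≥ 2k+1`; hence `|L|·P(N ≤ k) ≤ Σ_{b ≤ 2k+1}(|L|−b)P(b) ≤ Σ_{b ≤ |L|}(|L|−b)P(b) = |L| − U_L`. [this work] -/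
theorem pb_smallBall_avg (p : ι → unitInterval) (L : Finset ι) (k : ℕ) (hkU : (2 * k : ℝ) < ∑ i ∈ L, (p i : ℝ)) :
    (L.card : ℝ) * (prodBernoulli p).real {s : Set ι | (L.filter fun x => x ∈ s).card ≤ k} ≤
      (L.card : ℝ) - ∑ i ∈ L, (p i : ℝ) := by
  set μ := prodBernoulli p with hμ
  set U : ℝ := ∑ i ∈ L, (p i : ℝ) with hU
  set m : ℕ := L.card with hm
  set P : ℕ → ℝ := fun b => μ.real {s : Set ι | (L.filter fun x => x ∈ s).card = b} with hP
  have hP0 : ∀ b, 0 ≤ P b := fun b => measureReal_nonneg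
  -- `U ≤ m`, hence `2k + 1 ≤ m`
  have hUm : U ≤ (m : ℝ) := by
    have : ∑ i ∈ L, (p i : ℝ) ≤ ∑ i ∈ L, (1 : ℝ) := Finset.sum_le_sum fun i _ => (p i).2.2
    rw [Finset.sum_const, nsmul_eq_mul, mul_one] at this
    exact this
  have hkm : 2 * k + 1 ≤ m := by
    have : (2 * k : ℝ) < m := lt_of_lt_of_le hkU hUm
    exact_mod_cast this
  -- the level decomposition of `P(N ≤ k)` and the mean identity
  rw [pb_real_le_eq_sum p L k, Finset.mul_sum]
  have hmean : ∑ b ∈ Finset.range (m + 1), (b : ℝ) * P b = U := pb_mean p L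
  have hone : ∑ b ∈ Finset.range (m + 1), P b = 1 := pb_levels_sum_one p L
  -- target: `Σ_{b ≤ k} m P(b) ≤ Σ_{b ≤ m} (m − b) P(b) = m − U`
  have hrhs : ∑ b ∈ Finset.range (m + 1), ((m : ℝ) - b) * P b = (m : ℝ) - U := by
    have e : ∀ b : ℕ, ((m : ℝ) - b) * P b = (m : ℝ) * P b - (b : ℝ) * P b := fun b => by ring
    rw [Finset.sum_congr rfl fun b _ => e b, Finset.sum_sub_distrib, ← Finset.mul_sum, hone, hmean, mul_one]
  rw [← hrhs]
  -- split `m P(b) = (m − b) P(b) + b P(b)` on `b ≤ k`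
  have hsplit : ∑ b ∈ Finset.range (k + 1), (m : ℝ) * P b =
      ∑ b ∈ Finset.range (k + 1), ((m : ℝ) - b) * P b + ∑ b ∈ Finset.range (k + 1), (b : ℝ) * P b := by
    rw [← Finset.sum_add_distrib]
    exact Finset.sum_congr rfl fun b _ => by ring
  -- termwise: `b·P(b) ≤ (m − (2k+1−b))·P(2k+1−b)` for `b ≤ k`
  set g : ℕ → ℝ := fun b => ((m : ℝ) - b) * P b with hg
  have hg0 : ∀ b, b ≤ m → 0 ≤ g b := by
    intro b hb
    have : (b : ℝ) ≤ m := by exact_mod_cast hb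
    exact mul_nonneg (by linarith) (hP0 b)
  have hterm : ∀ b ∈ Finset.range (k + 1), (b : ℝ) * P b ≤ g (2 * k + 1 - b) := by
    intro b hb
    have hbk : b ≤ k := by have := Finset.mem_range.1 hb; omega
    have hcast : ((2 * k + 1 - b : ℕ) : ℝ) = 2 * k + 1 - b := by
      have h : b ≤ 2 * k + 1 := by omega
      push_cast [Nat.cast_sub h]
      ring
    have hcoef : (b : ℝ) ≤ (m : ℝ) - ((2 * k + 1 - b : ℕ) : ℝ) := by
      rw [hcast]
      have : ((2 * k + 1 : ℕ) : ℝ) ≤ m := by exact_mod_cast hkm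
      push_cast at this
      linarith
    rcases Nat.eq_zero_or_pos b with rfl | hbpos
    · simp only [Nat.cast_zero, zero_mul]
      exact hg0 _ (by omega)
    · have hmono : P b ≤ P (2 * k + 1 - b) :=
        pb_pmf_mono p L (by omega) (by
          rw [hcast]
          have hb1 : (1 : ℝ) ≤ b := by exact_mod_cast hbpos
          linarith)
      have hb0 : (0 : ℝ) ≤ b := Nat.cast_nonneg b
      calc (b : ℝ) * P b ≤ (b : ℝ) * P (2 * k + 1 - b) := mul_le_mul_of_nonneg_left hmono hb0
        _ ≤ ((m : ℝ) - ((2 * k + 1 - b : ℕ) : ℝ)) * P (2 * k + 1 - b) :=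
            mul_le_mul_of_nonneg_right hcoef (hP0 _)
  -- reflect: `Σ_{b ≤ k} g(2k+1−b) = Σ_{x ≤ k} g(k+1+x)`
  have hrefl : ∑ b ∈ Finset.range (k + 1), g (2 * k + 1 - b) = ∑ x ∈ Finset.range (k + 1), g (k + 1 + x) := by
    rw [← Finset.sum_range_reflect (fun x => g (k + 1 + x)) (k + 1)]
    refine Finset.sum_congr rfl fun b hb => ?_
    have := Finset.mem_range.1 hb
    congr 1
    omega
  have hsecond : ∑ b ∈ Finset.range (k + 1), (b : ℝ) * P b ≤ ∑ x ∈ Finset.range (k + 1), g (k + 1 + x) := by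
    rw [← hrefl]
    exact Finset.sum_le_sum hterm
  -- assemble: `Σ_{b ≤ k} m P(b) ≤ Σ_{b ≤ 2k+1} g(b) ≤ Σ_{b ≤ m} g(b)`
  have hfirst : ∑ b ∈ Finset.range (k + 1), ((m : ℝ) - b) * P b = ∑ b ∈ Finset.range (k + 1), g b := rfl
  have hjoin : ∑ b ∈ Finset.range (k + 1), g b + ∑ x ∈ Finset.range (k + 1), g (k + 1 + x) =
      ∑ b ∈ Finset.range (k + 1 + (k + 1)), g b := (Finset.sum_range_add g (k + 1) (k + 1)).symm
  have hsub : Finset.range (k + 1 + (k + 1)) ⊆ Finset.range (m + 1) := by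
    intro b hb
    rw [Finset.mem_range] at hb ⊢
    omega
  calc ∑ b ∈ Finset.range (k + 1), (m : ℝ) * P b
      = ∑ b ∈ Finset.range (k + 1), g b + ∑ b ∈ Finset.range (k + 1), (b : ℝ) * P b := by rw [hsplit, hfirst]
    _ ≤ ∑ b ∈ Finset.range (k + 1), g b + ∑ x ∈ Finset.range (k + 1), g (k + 1 + x) := by linarith [hsecond]
    _ = ∑ b ∈ Finset.range (k + 1 + (k + 1)), g b := hjoin
    _ ≤ ∑ b ∈ Finset.range (m + 1), g b :=
        Finset.sum_le_sum_of_subset_of_nonneg hsub fun b hb _ => hg0 b (by have := Finset.mem_range.1 hb; omega)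
    _ = ∑ b ∈ Finset.range (m + 1), ((m : ℝ) - b) * P b := rfl

/-- **The average-gate star row, probability form**: for a nonempty `L` with `2k < U_L`, `P(N_L ≤ k) ≤ 1 − U_L/|L|`. [this work] -/
theorem pb_smallBall_avg_div (p : ι → unitInterval) (L : Finset ι) (hL : L.Nonempty) (k : ℕ)
    (hkU : (2 * k : ℝ) < ∑ i ∈ L, (p i : ℝ)) :
    (prodBernoulli p).real {s : Set ι | (L.filter fun x => x ∈ s).card ≤ k} ≤
      1 - (∑ i ∈ L, (p i : ℝ)) / L.card := by
  have hm : (0 : ℝ) < L.card := by exact_mod_cast Finset.card_pos.2 hL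
  have : (prodBernoulli p).real {s : Set ι | (L.filter fun x => x ∈ s).card ≤ k} * (L.card : ℝ) ≤
      (L.card : ℝ) - ∑ i ∈ L, (p i : ℝ) := by rw [mul_comm]; exact pb_smallBall_avg p L k hkU
  calc (prodBernoulli p).real {s : Set ι | (L.filter fun x => x ∈ s).card ≤ k}
      = ((prodBernoulli p).real {s : Set ι | (L.filter fun x => x ∈ s).card ≤ k} * (L.card : ℝ)) / L.card := by
          field_simp
    _ ≤ ((L.card : ℝ) - ∑ i ∈ L, (p i : ℝ)) / L.card := div_le_div_of_nonneg_right this hm.le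
    _ = 1 - (∑ i ∈ L, (p i : ℝ)) / L.card := by field_simp

end Quant

end Summit.CriticalPhenomena.PercolationContinuityZ3.Theorems
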